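import Literature.MathematicalPhysics.QuantumFieldTheory.Balaban1983to89.BlockAveragingPlaquetteBound
import Literature.MathematicalPhysics.QuantumFieldTheory.Balaban1983to89.B15PrelimIntegrations
import HarnessLib

/-!
# Route `UnitScaleTilt`, crux K1 «MinimiserStabilityRegPr» (stmt-QuantumFields-19200), leaf V2′ `stub_halvingStep` — sub-lemma C_k / P0, FILE 1 of 2:
# **THE TRANSPORT COMPARISON OF THE (0.4)-DESCENT WITH THE STRAIGHT FINE TRANSPORTERS** (the nonlinear port `Ū^{(i)}(w) ≈ U(refineⁱ w)`)

Cell `ym3-torus` ∕ fleet seat `ym-ust-19200-p2` g5.  WHY.  The k-fold Euler–Lagrange / chart theorems of this lineage (p516212, p519004, p526141,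
p526705) carry the explicit hypothesis «all iterated (0.4)-averages `Ū^{(i)}`, `i < k`, are `t₀`-small»; file 2 (`…IterPlaqSmall`) discharges it
k-UNIFORMLY from the plaquette clause of [Balaban1985Variational] (2)/(6) alone (block size `L ≥ 7`).  This file is the engine: the comparison of
the holonomies of the `i`-fold average `Ū^{(i)}` along a level-`i` walk with the holonomies of the FINE field along the straight refinement of the
walk, at the cost of the correction factors of [Balaban1987RG1] (0.4) inserted one at a time ([Balaban1985Averaging] (19)–(20)).

WHAT IS PROVED (sorry-free, definition-free; any `GaugeGroup`, any `LoopAverage ℰ` in §4; `SU(N)` with the printed `exp[mean log]` in §2).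
* §1 `norm_eml_sub_one_le_div`: `‖eml W − 1‖ ≤ s·e^s`, `s = t/(1−t)`, if all `‖W_i − 1‖ ≤ t < 1` (via `MatrixLog.norm_mlog_le_div`; the tree's
  `norm_eml_sub_one_le` has `2t·e^{2t}`); `norm_eml_sub_one_le_lin`: `≤ (21/20)·t` for `t ≤ 1/50`.
* §2 `dist1_ESU_le_lin`, `dist1_expMeanLogSU_avg_le_lin`; **`dist1_corr_le_of_loopHol`**: if every (0.4) loop variable of `V` at `c` is within
  `t ≤ 1/50`, `t < δ_N`, of `1`, then `dist1 (corr ℰp V c) ≤ (21/20)t` (off the guard `corr = 1`).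
* §3 bookkeeping for the refined word `w.flatMap (replicate L)` and its iterate `(flatMap (replicate L))^[i]`: lengths `L·|w|`, `Lⁱ·|w|`; net
  displacements multiplied by `L`, `Lⁱ` (closed words stay closed); the backward straight segment from a block centre (`walkEnd_replicate_L_false`,
  `holAt_walk_replicate_L_false`).
* §4 **`dist1_holAt_avgFun_mul_inv_le`** (ONE STEP): `∀ c, dist1 (corr ℰ U c) ≤ κ ⇒ dist1(Ū(w)·U(refine w from emb y)⁻¹) ≤ |w|·κ`;
  **`dist1_holAt_iter_mul_inv_le`** (`i` STEPS): with level-wise bounds `κ_{i'}` (`i' < k`) on the correction factors and any super-solution `τ`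
  of `τ_{i+1} ≥ κ_i + Lτ_i`, `τ₀ ≥ 0`: for `i ≤ k`, `dist1(Ū^{(i)}(w)·U(refineⁱ w from a fine base point)⁻¹) ≤ |w|·τ_i`.
HONEST SCOPE.  Elementary group-norm bookkeeping; no estimate of Bałaban's is claimed.  NOT a claim about the mass gap.

References: T. Bałaban, CMP **98** (1985) 17–51 [Balaban1985Averaging] ((19)–(20), (26)–(27) pp.21–22); CMP **109** (1987) 249–301 [Balaban1987RG1]
((0.3)–(0.4), (0.11) pp.252–253); CMP **102** (1985) 277–309 [Balaban1985Variational] ((146) p.301).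
-/

noncomputable section

open scoped BigOperators

namespace Summit.QuantumFields.YangMills.Theorems.IterPlaqSmall

open Literature.MathematicalPhysics.QuantumFieldTheory.Balaban1983to89
open T4Continuum T4ReflectionCone BlockAveraging ExpMeanLog MatrixLog LatticeWordStokes BlockAveragingPlaquetteBound

/-! ## §1 The modulus of `exp[mean log]` near `1`, sharp form -/

section Modulus

open B7BlockAvgLog

variable {𝔸 : Type*} [NormedRing 𝔸] [NormedAlgebra ℂ 𝔸] [CompleteSpace 𝔸] {ι : Type*} [Fintype ι]

/-- **`‖eml W − 1‖ ≤ s·e^s`, `s = t/(1−t)`**, if every `‖W_i − 1‖ ≤ t < 1` (nonempty family): `‖log W_i‖ ≤ ‖W_i − 1‖/(1 − ‖W_i − 1‖) ≤ s`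
(`MatrixLog.norm_mlog_le_div`), the mean has norm `≤ s`, and `‖e^Z − 1‖ ≤ ‖Z‖e^{‖Z‖}`. [cite: Balaban1985Averaging, (26)-(27) p.22] -/
theorem norm_eml_sub_one_le_div [Nonempty ι] {W : ι → 𝔸} {t : ℝ} (hW : ∀ i, ‖W i - 1‖ ≤ t) (ht : t < 1) :
    ‖eml W - 1‖ ≤ (t / (1 - t)) * Real.exp (t / (1 - t)) := by
  have hc : (0 : ℝ) < Fintype.card ι := Nat.cast_pos.mpr Fintype.card_pos
  have h0 : 0 ≤ t := (norm_nonneg _).trans (hW (Classical.arbitrary ι))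
  have hK : ‖∑ x ∈ Finset.univ, ((Fintype.card ι : ℝ))⁻¹ • ((Complex.I⁻¹ : ℂ) • mlog (W x))‖ ≤ t / (1 - t) := by
    refine (norm_sum_le _ _).trans ?_
    have hterm : ∀ x ∈ (Finset.univ : Finset ι),
        ‖((Fintype.card ι : ℝ))⁻¹ • ((Complex.I⁻¹ : ℂ) • mlog (W x))‖ ≤ ((Fintype.card ι : ℝ))⁻¹ * (t / (1 - t)) := by
      intro x _
      rw [norm_smul, norm_inv, Real.norm_natCast, norm_smul, norm_inv, Complex.norm_I, inv_one, one_mul]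
      refine mul_le_mul_of_nonneg_left ?_ (inv_nonneg.mpr hc.le)
      have hx1 : ‖W x - 1‖ < 1 := (hW x).trans_lt ht
      refine (norm_mlog_le_div hx1).trans ?_
      rw [div_le_div_iff₀ (by linarith) (by linarith)]
      nlinarith [hW x, norm_nonneg (W x - 1)]
    refine (Finset.sum_le_sum hterm).trans ?_
    rw [Finset.sum_const, Finset.card_univ, nsmul_eq_mul, ← mul_assoc, mul_inv_cancel₀ hc.ne', one_mul]
  exact norm_barAvg_sub_one_le Finset.univ (fun _ => ((Fintype.card ι : ℝ))⁻¹) W hK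

/-- The same with a linear constant: **`‖eml W − 1‖ ≤ (21/20)·t` for `t ≤ 1/50`** (`s ≤ (50/49)t`, `e^s ≤ 1 + s + s²`).
[cite: Balaban1985Averaging, (26)-(27) p.22] -/
theorem norm_eml_sub_one_le_lin [Nonempty ι] {W : ι → 𝔸} {t : ℝ} (hW : ∀ i, ‖W i - 1‖ ≤ t) (ht : t ≤ 1 / 50) :
    ‖eml W - 1‖ ≤ 21 / 20 * t := by
  have h0 : 0 ≤ t := (norm_nonneg _).trans (hW (Classical.arbitrary ι))
  refine (norm_eml_sub_one_le_div hW (by linarith)).trans ?_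
  set s : ℝ := t / (1 - t) with hs_def
  have hs0 : 0 ≤ s := div_nonneg h0 (by linarith)
  have hs1 : s ≤ 50 / 49 * t := by
    rw [hs_def, div_le_iff₀ (by linarith)]
    nlinarith
  have hs2 : s ≤ 1 / 49 := by linarith
  have hexp : Real.exp s ≤ 1 + s + s ^ 2 := by
    have h := Real.abs_exp_sub_one_sub_id_le (x := s) (by rw [abs_of_nonneg hs0]; linarith)
    have := (abs_le.mp h).2
    linarith
  calc s * Real.exp s ≤ s * (1 + s + s ^ 2) := mul_le_mul_of_nonneg_left hexp hs0
    _ ≤ s * (1 + 1 / 49 + (1 / 49) ^ 2) := by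
        refine mul_le_mul_of_nonneg_left ?_ hs0
        nlinarith
    _ ≤ 21 / 20 * t := by nlinarith

end Modulus

/-! ## §2 On `SU(N)`: the guarded small-loop average -/

section SUN

open scoped Matrix.Norms.L2Operator

variable {n : Type*} [Fintype n] [DecidableEq n] [Nonempty n] {ι : Type*} [Fintype ι]

/-- `dist1 (ESU W) ≤ (21/20)·t` for an `SU(N)` family with every `dist1 (W i) ≤ t ≤ 1/50`, `t < δ_N` (the guard holds and `ESU = exp[mean log]`).
[cite: Balaban1987RG1, (0.4) p.253] -/
theorem dist1_ESU_le_lin [Nonempty ι] {W : ι → Matrix.specialUnitaryGroup n ℂ} {t : ℝ} (hW : ∀ i, dist1 (W i) ≤ t)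
    (ht : t ≤ 1 / 50) (hδ : t < deltaSU n) : dist1 (ESU W) ≤ 21 / 20 * t := by
  have hsmall : ∀ i, ‖(W i : Matrix n n ℂ) - 1‖ < deltaSU n := fun i => (hW i).trans_lt hδ
  show ‖((ESU W : Matrix.specialUnitaryGroup n ℂ) : Matrix n n ℂ) - 1‖ ≤ 21 / 20 * t
  rw [coe_ESU_of_small hsmall]
  exact norm_eml_sub_one_le_lin (fun i => hW i) ht

/-- The same for the small-loop average `expMeanLogSU.avg` over any nonempty finite index type. [cite: Balaban1987RG1, (0.4) and (0.7) p.253] -/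
theorem dist1_expMeanLogSU_avg_le_lin [Nonempty ι] {W : ι → Matrix.specialUnitaryGroup n ℂ} {t : ℝ} (hW : ∀ i, dist1 (W i) ≤ t)
    (ht : t ≤ 1 / 50) (hδ : t < deltaSU n) : dist1 ((expMeanLogSU (n := n)).avg W) ≤ 21 / 20 * t := by
  unfold LoopAverage.avg
  exact dist1_ESU_le_lin (fun i => hW _) ht hδ

/-- **THE CORRECTION FACTOR FROM LOOP BOUNDS** (any level, any field): if every (0.4) loop variable of `V` at the coarse bond `c` is within
`t ≤ 1/50`, `t < δ_N`, of `1`, then `dist1 (corr ℰp V c) ≤ (21/20)·t` — on the guard by §1, off it `corr = 1`. [cite: Balaban1987RG1, (0.4) p.253] -/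
theorem dist1_corr_le_of_loopHol {P : Params} {j : ℕ} (V : GaugeField P j (Matrix.specialUnitaryGroup n ℂ)) (c : PBond P (j + 1))
    {t : ℝ} (hW : ∀ i : Idx P, dist1 (loopHol V c i) ≤ t) (ht : t ≤ 1 / 50) (hδ : t < deltaSU n) :
    dist1 (corr (expMeanLogSU (n := n)) V c) ≤ 21 / 20 * t := by
  have h0 : 0 ≤ t := (GaugeGroup.dist1_nonneg _).trans (hW (Classical.arbitrary _))
  unfold corr
  split_ifs with h
  · exact dist1_expMeanLogSU_avg_le_lin hW ht hδ
  · rw [GaugeGroup.dist1_one]; positivity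

end SUN

/-! ## §3 Refined words (bookkeeping, definition-free: `List.flatMap` / `Nat.iterate`) -/

section Words

variable {d : ℕ}

/-- The STRAIGHT REFINEMENT `w.flatMap (replicate L)` of a word by the block size `L` (every letter repeated `L` times: a coarse step `±e_μ` from a
block centre is the straight fine walk of `L` steps between the two block centres, [Balaban1987RG1] p.252) has length `L·|w|`. [cite: Balaban1987RG1, (0.3) p.252] -/
theorem length_flatMap_replicate (L : ℕ) : ∀ w : List (Letter d), (w.flatMap (fun l => List.replicate L l)).length = L * w.length
  | [] => by simp
  | l :: w => by
    rw [List.flatMap_cons, List.length_append, List.length_replicate, length_flatMap_replicate L w, List.length_cons]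
    ring

/-- The refined word has `L` times the net displacement. [folklore] -/
theorem netDisp_flatMap_replicate (L : ℕ) : ∀ (w : List (Letter d)) (κ : Fin d),
    netDisp (w.flatMap (fun l => List.replicate L l)) κ = L * netDisp w κ
  | [], κ => by simp [netDisp]
  | l :: w, κ => by
    rw [List.flatMap_cons, netDisp_append, netDisp_replicate, netDisp_flatMap_replicate L w κ, netDisp_cons]
    ring

/-- `|refineⁱ w| = Lⁱ·|w|` for the `i`-fold refinement `(flatMap (replicate L))^[i]`. [folklore] -/
theorem length_iterate_flatMap_replicate (L : ℕ) : ∀ (i : ℕ) (w : List (Letter d)),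
    ((fun w : List (Letter d) => w.flatMap (fun l => List.replicate L l))^[i] w).length = L ^ i * w.length
  | 0, w => by simp
  | i + 1, w => by
    rw [Function.iterate_succ_apply, length_iterate_flatMap_replicate L i, length_flatMap_replicate, pow_succ]; ring

/-- The `i`-fold refinement multiplies net displacements by `Lⁱ` (so closed words stay closed). [folklore] -/
theorem netDisp_iterate_flatMap_replicate (L : ℕ) : ∀ (i : ℕ) (w : List (Letter d)) (κ : Fin d),
    netDisp ((fun w : List (Letter d) => w.flatMap (fun l => List.replicate L l))^[i] w) κ = L ^ i * netDisp w κ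
  | 0, w, κ => by simp
  | i + 1, w, κ => by
    rw [Function.iterate_succ_apply, netDisp_iterate_flatMap_replicate L i, netDisp_flatMap_replicate, pow_succ]; ring

end Words

section Sites

variable {P : Params} {j : ℕ}

/-- The straight walk of `L` steps `−e_μ` from the centre of `B(y)` ends at the centre of `B(y − e_μ)`. [folklore] -/
theorem walkEnd_replicate_L_false (y : Site P (j + 1)) (μ : Fin P.d) :
    walkEnd (emb y) (List.replicate P.L (μ, false)) = emb (y.unshift μ) := by
  have h := walkEnd_walkEnd_wordRev (emb (y.unshift μ)) (List.replicate P.L (μ, true))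
  rw [walkEnd_replicate_L, Site.shift_unshift, wordRev_replicate] at h
  exact h

variable {G : Type*} [GaugeGroup G]

/-- The straight transporter backwards: the holonomy of `L` steps `−e_μ` from `emb y` is `U(⟨y − e_μ, μ⟩)⁻¹` (coarse bond variable of the
axial averaging). [cite: Balaban1987RG1, (0.4) p.253] -/
theorem holAt_walk_replicate_L_false (U : GaugeField P j G) (y : Site P (j + 1)) (μ : Fin P.d) :
    holAt U (walk (emb y) (List.replicate P.L (μ, false))) = (AveragingRT.axialAvg U ⟨y.unshift μ, μ⟩)⁻¹ := by
  have h := holAt_walk_wordRev U (emb (y.unshift μ)) (List.replicate P.L (μ, true))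
  rw [walkEnd_replicate_L, Site.shift_unshift, wordRev_replicate] at h
  rw [axialAvg_eq_holAt_walk]
  exact h

end Sites

/-! ## §4 The transport comparison: one step and `i` steps -/

section Transport

variable {P : Params} {j : ℕ} {G : Type*} [GaugeGroup G]

/-- **ONE STEP**: if every correction factor of `Ū = avgFun ℰ U` is within `κ` of `1`, then for every coarse walk `w` from `y` the coarse holonomy
`Ū(w)` and the fine holonomy of the refined walk `w.flatMap (replicate L)` from the block centre `emb y` satisfy `dist1(Ū(w)·U(refine w)⁻¹) ≤ |w|·κ`
(the correction factors are inserted one at a time; unitary invariance (19)–(20)). [cite: Balaban1985Averaging, (19)-(20) p.21; Balaban1987RG1, (0.4) p.253] -/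
theorem dist1_holAt_avgFun_mul_inv_le (ℰ : LoopAverage G) (U : GaugeField P j G) {κ : ℝ} (hκ0 : 0 ≤ κ)
    (hκ : ∀ c : PBond P (j + 1), dist1 (corr ℰ U c) ≤ κ) :
    ∀ (w : List (Letter P.d)) (y : Site P (j + 1)),
      dist1 (holAt (avgFun ℰ U) (walk y w) * (holAt U (walk (emb y) (w.flatMap (fun l => List.replicate P.L l))))⁻¹) ≤ w.length * κ
  | [], y => by
    simp only [List.flatMap_nil, walk, holAt_nil, inv_one, mul_one, GaugeGroup.dist1_one, List.length_nil, Nat.cast_zero, zero_mul]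
    exact le_rfl
  | (μ, true) :: w, y => by
    have ih := dist1_holAt_avgFun_mul_inv_le ℰ U hκ0 hκ w (y.shift μ)
    rw [List.flatMap_cons, walk_append, holAt_append, walkEnd_replicate_L, ← axialAvg_eq_holAt_walk U ⟨y, μ⟩]
    simp only [walk, holAt_cons, ↓reduceIte, List.length_cons, Nat.cast_succ]
    set X := holAt (avgFun ℰ U) (walk (y.shift μ) w)
    set Y := holAt U (walk (emb (y.shift μ)) (w.flatMap (fun l => List.replicate P.L l)))
    set A := AveragingRT.axialAvg U ⟨y, μ⟩
    have hV : avgFun ℰ U ⟨y, μ⟩ = corr ℰ U ⟨y, μ⟩ * A := rfl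
    have hre : avgFun ℰ U ⟨y, μ⟩ * X * (A * Y)⁻¹ = corr ℰ U ⟨y, μ⟩ * (A * (X * Y⁻¹) * A⁻¹) := by
      rw [hV]; simp only [mul_inv_rev, mul_assoc]
    rw [hre]
    calc dist1 (corr ℰ U ⟨y, μ⟩ * (A * (X * Y⁻¹) * A⁻¹))
        ≤ dist1 (corr ℰ U ⟨y, μ⟩) + dist1 (A * (X * Y⁻¹) * A⁻¹) := GaugeGroup.dist1_mul_le _ _
      _ = dist1 (corr ℰ U ⟨y, μ⟩) + dist1 (X * Y⁻¹) := by rw [GaugeGroup.dist1_conj]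
      _ ≤ κ + w.length * κ := add_le_add (hκ _) ih
      _ = (w.length + 1) * κ := by ring
  | (μ, false) :: w, y => by
    have ih := dist1_holAt_avgFun_mul_inv_le ℰ U hκ0 hκ w (y.unshift μ)
    rw [List.flatMap_cons, walk_append, holAt_append, walkEnd_replicate_L_false, holAt_walk_replicate_L_false]
    simp only [walk, holAt_cons, Bool.false_eq_true, ↓reduceIte, List.length_cons, Nat.cast_succ]
    set X := holAt (avgFun ℰ U) (walk (y.unshift μ) w)
    set Y := holAt U (walk (emb (y.unshift μ)) (w.flatMap (fun l => List.replicate P.L l)))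
    set A := AveragingRT.axialAvg U ⟨y.unshift μ, μ⟩
    have hV : avgFun ℰ U ⟨y.unshift μ, μ⟩ = corr ℰ U ⟨y.unshift μ, μ⟩ * A := rfl
    have hre : (avgFun ℰ U ⟨y.unshift μ, μ⟩)⁻¹ * X * (A⁻¹ * Y)⁻¹ =
        A⁻¹ * ((corr ℰ U ⟨y.unshift μ, μ⟩)⁻¹ * (X * Y⁻¹)) * A⁻¹⁻¹ := by
      rw [hV]; simp only [mul_inv_rev, inv_inv, mul_assoc]
    rw [hre, GaugeGroup.dist1_conj]
    calc dist1 ((corr ℰ U ⟨y.unshift μ, μ⟩)⁻¹ * (X * Y⁻¹))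
        ≤ dist1 ((corr ℰ U ⟨y.unshift μ, μ⟩)⁻¹) + dist1 (X * Y⁻¹) := GaugeGroup.dist1_mul_le _ _
      _ = dist1 (corr ℰ U ⟨y.unshift μ, μ⟩) + dist1 (X * Y⁻¹) := by rw [GaugeGroup.dist1_inv]
      _ ≤ κ + w.length * κ := add_le_add (hκ _) ih
      _ = (w.length + 1) * κ := by ring

/-- The iterated (0.4)-average one level up is `avgFun` of the previous one (definitional). [cite: Balaban1987RG1, (0.11) p.253] -/
theorem iter_succ_eq (ℰ : LoopAverage G) (i : ℕ) (U : GaugeField P 0 G) :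
    Averaging.iter (fun j => blockAvg (P := P) (j := j) ℰ) (i + 1) U = avgFun ℰ (Averaging.iter (fun j => blockAvg (P := P) (j := j) ℰ) i U) := by
  show ((blockAvg (P := P) (j := i) ℰ).avg ∘ Averaging.iter (fun j => blockAvg (P := P) (j := j) ℰ) i) U = _
  rfl

/-- **`i` STEPS — THE NONLINEAR PORT OF THE (0.4)-DESCENT TO STRAIGHT TRANSPORTERS**: if for every level `i' < k` every correction factor of the
`(i'+1)`-st average is within `κ_{i'}` of `1`, and `τ` is a super-solution of the recursion (`0 ≤ τ₀`, `κ_i + L·τ_i ≤ τ_{i+1}`), then for `i ≤ k` and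
every level-`i` walk `w` from `y` there is a fine base point `x` (the iterated block centre of `y`) with
`dist1(Ū^{(i)}(w)·U(refineⁱ w from x)⁻¹) ≤ |w|·τ_i`. [cite: Balaban1987RG1, (0.4) and (0.11) p.253; Balaban1985Averaging, (19)-(20) p.21] -/
theorem dist1_holAt_iter_mul_inv_le (ℰ : LoopAverage G) (U : GaugeField P 0 G) (k : ℕ) {κ τ : ℕ → ℝ} (hκ0 : ∀ i, 0 ≤ κ i)
    (hτ0 : 0 ≤ τ 0) (hτ : ∀ i, κ i + (P.L : ℝ) * τ i ≤ τ (i + 1))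
    (hκ : ∀ i, i < k → ∀ c : PBond P (i + 1), dist1 (corr ℰ (Averaging.iter (fun j => blockAvg (P := P) (j := j) ℰ) i U) c) ≤ κ i) :
    ∀ i, i ≤ k → ∀ (w : List (Letter P.d)) (y : Site P i), ∃ x : Site P 0,
      dist1 (holAt (Averaging.iter (fun j => blockAvg (P := P) (j := j) ℰ) i U) (walk y w) *
        (holAt U (walk x ((fun w : List (Letter P.d) => w.flatMap (fun l => List.replicate P.L l))^[i] w)))⁻¹) ≤ w.length * τ i
  | 0, _, w, y => by
    refine ⟨y, ?_⟩
    simp only [Function.iterate_zero, id_eq]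
    show dist1 (holAt U (walk y w) * (holAt U (walk y w))⁻¹) ≤ w.length * τ 0
    rw [mul_inv_cancel, GaugeGroup.dist1_one]
    positivity
  | i + 1, hi, w, y => by
    have hik : i < k := Nat.lt_of_succ_le hi
    have h1 := dist1_holAt_avgFun_mul_inv_le ℰ (Averaging.iter (fun j => blockAvg (P := P) (j := j) ℰ) i U) (hκ0 i) (hκ i hik) w y
    obtain ⟨x, h2⟩ := dist1_holAt_iter_mul_inv_le ℰ U k hκ0 hτ0 hτ hκ i hik.le (w.flatMap (fun l => List.replicate P.L l)) (emb y)
    refine ⟨x, ?_⟩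
    rw [iter_succ_eq, Function.iterate_succ_apply]
    refine (B15.PrelimIntegrations.dist1_fluct_le _ _ _).trans ((add_le_add h1 h2).trans ?_)
    rw [length_flatMap_replicate, Nat.cast_mul]
    have hlen : (0 : ℝ) ≤ w.length := Nat.cast_nonneg _
    have := hτ i
    nlinarith [mul_le_mul_of_nonneg_left this hlen]

end Transport

end Summit.QuantumFields.YangMills.Theorems.IterPlaqSmall

end
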